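/-
Copyright (c) 2026 the pub-hodgecm-mathlib formalisation cell (harness21).  Prover seat hodgecm-mathlib-K2E2-p12 (g10), Track B «K2-LIT», h413 = `stmt-HodgeConjecture-24833`,
route `HCCMUnconditional`; R90-TF section S8 «ContSpec-n½», deal S8-R254 (5) (S8 dealer R90-CS-plan (g4)), FILE A of (R)′τ OF RECORD ED. 3: THE FACTORISED SCATTERING COLUMNS OF EVERY
τ-ADMISSIBLE GENERATOR, OF PORTS — per pure piece the un-projected K-finite export (★ p865131) + ★ p864880's Euler factorisation + off-axis exclusion, then concatenation;
census `R90/S8/CENSUS-RprimeV3.K2E2-p12-g10.md` 97bff6d02ef9c729.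
-/
import Summits.HodgeConjecture.HodgeConjecture.Theorems.R90S8ResGMidTauExportsRowOfPortsU3                      -- ★ p865131 (K2E3-p29): `chiEisenstein_meromorphic_exports_kfinite_with_truncatedFamily_of_ports_of_coweightLine`; brings ★ p864597 FILE A binders, ★ p865084, ★ §5d pure split
import Summits.HodgeConjecture.HodgeConjecture.Theorems.R90S8KTypeCoweightLineProductU3                         -- ★ p864934 (K2E1-p12 g6): `hCO_of_transposeRealisations` (J-S8-CO (5))
import Summits.HodgeConjecture.HodgeConjecture.Theorems.K2E1ChiScatteringCoordsEulerFactorisationKFiniteCMThree  -- ★ p864880 (this seat): `exists_eulerFactorisation_of_tubeClause`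
import Summits.HodgeConjecture.HodgeConjecture.Theorems.K2E1ChiIntertwinedCoeffKMaxCMThree                     -- ★ p864262 (K2E1-p11): `integrable_flatSectionU_weylLongU_mul`
import Summits.HodgeConjecture.HodgeConjecture.Theorems.R90S8TubeSeedOperatorLettersU3                          -- ★ `exists_bound_of_mem_chiSectionSpacePair_midBlock`
import HarnessLib

/-!
# S8 sub-socket (R)′ — `R90S8ResGMidTauColumnsOfPortsU3` ((R)′τ OF RECORD ED. 3, FILE A): THE FACTORISED SCATTERING COLUMNS OF EVERY τ-ADMISSIBLE GENERATOR, OF PORTS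

Track B ∕ R90-TF, crux h413 = `stmt-HodgeConjecture-24833`, route `HCCMUnconditional`; cell `hodgecm-mathlib`, S8 «ContSpec-n½», sub-socket (R)′ (B ED. 7 :337), (R)′τ OF RECORD ED. 3
(S8-R254 (5)).  THEOREMS ONLY (no `def`∕`instance`∕`notation`, no named-fact hypothesis, no `sorry`, default heartbeats); lane `--supports … --as helper`; CLOSES NO SOCKET.

WHY (census 97bff6d02ef9c729 (2)).  ★ V2 (`R90S8ResGMidBlockLeResidualOfRecordV2U3`) carried, per τ-generator, a COLUMNS letter `hCOLS` asking for LINEARLY INDEPENDENT scattering columns of the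
generator; for an arch-finite generator `φ = Σ cᵢ` split into pure `K_max`-irreducible pieces (★ `exists_finset_sum_pure_blocks_of_isArchFinite`) the concatenated columns of the pieces
are NOT independent in general (two pieces of the same `K_∞`-type share their reflected column space), so `hCOLS` cannot be discharged as stated.  THIS FILE restructures: PER PURE
PIECE the un-projected K-finite export WITH COLUMNS at closed ports (★ p865131 §1.2 with ★ p864597's binder discharges replayed from ★ `hPURE6_of_coweightLines'` — columns KEPT — and
the co-weight line ★ `hCO_of_transposeRealisations`), PER PIECE the Euler factorisation `q_j = c_S·a_j` (★ p864880 Cramer at points of `K_max`, of the letter `hunfK` at the scalar of record,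
the piece's columns being independent) and PER PIECE the off-axis exclusion (`hPreal`, stated over independent column data), then CONCATENATION over the sigma index type: the tube
clause adds up (★ `flatSectionU_finsetSum`, `integral_finsetSum` with ★ `integrable_flatSectionU_weylLongU_mul`), the candidate sets unite (★ p865084's pattern), and nothing downstream
(★ `exists_hSCAT_of_factorisation`) needs independence.
* §1 **`columnsRow_of_pureBlock (hμu)`** — at a pure block with ★ §5d's package and a normalised Heisenberg package: `∀ φ ∈ V`, columns `φ′` (independent `(χ₁ʷ, χ₂)`-pair-sections,
  continuous, bounded), coordinates `qv`, continued coordinates `qcv` IN NORMAL FORM (★ (E1)), analytic off a co-discrete `Pv ⊆ {Re ≤ 2}`, `= qv` on the tube, and the tube clause in ★ p864481's bytes.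
* §2 HEAD **`columnsFactorisedRow_of_ports (hμu) (hunfK) (hPreal)`** — at every τ-admissible generator and normalised package: the concatenated columns WITH the factorisation
  `qv_j = c_S·a_j` (`a_j` holomorphic on `{1<Re}`) and off-axis analyticity of every `qcv_j` in `{1<Re}` — the row FILE B (`…LeResidualOfRecordV3U3`) binds in place of V2's `hCOLS hunfK hPreal`.
LETTERS (visible): `hμu`; the exports frame `νG β hβ μZ hμZ` and the ports' Haar frame `μa μf`; PER τ-ADMISSIBLE SECTION `hunfK` (★ p864880's bytes, `cS :=` ★ F5's ratio of record) and
`hPreal` (off-axis exclusion over independent column data IN NORMAL FORM — ruling J-S8-AXIS (2): ★ V2's bytes + the clause `(∀ j, MeromorphicNFOn (qcv j) univ)`).  No `hCO`, no `hTEXP6`, no `hCOLS`.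
HONEST LABEL: HC_CM is proved only modulo the 7 printed citations (2 remaining named inputs: hLiu418 = `stmt-HodgeConjecture-24832`, h413 = `stmt-HodgeConjecture-24833`) until
rung 0 closes; REL ≠ ★ ≠ BUILT; composition only, conditional on `hunfK`, `hPreal`; closes no socket; count-neutral.

## References
* [MoeglinWaldspurger1995] C. Mœglin, J.-L. Waldspurger, *Spectral Decomposition and Eisenstein Series* (1995), II.1.5–II.1.7, IV.1.9–IV.1.11.
* [BernsteinLapid2019] J. Bernstein, E. Lapid, *On the meromorphic continuation of Eisenstein series*, J. AMS 37 (2024), Thm 2.3, §4, §7.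
* [Langlands1976] R. P. Langlands, *On the Functional Equations Satisfied by Eisenstein Series*, LNM 544 (1976), §6.
* [Knapp1986] A. W. Knapp, *Representation Theory of Semisimple Groups* (1986), VII §1–§2.
-/

set_option autoImplicit false
set_option linter.dupNamespace false  -- the mandated namespace `…HodgeConjecture.HodgeConjecture.R90.S8` (LEAD #1 L1) repeats the summit's segment

noncomputable section

open MeasureTheory Measure Set Filter Topology NumberField IsDedekindDomain ContRepresentation
open Literature.NumberTheory Literature.NumberTheory.Automorphic Literature.NumberTheory.Automorphic.UnitaryGroup Literature.NumberTheory.GaloisRepresentations AdelicGroupData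
open Literature.NumberTheory.Automorphic.Arthur2013.Leaves.TECR Literature.NumberTheory.Rogawski1990 Literature.NumberTheory.LFunctions
open Summit.HodgeConjecture.HodgeConjecture.Cruxes.H413.K2E1BorelEisensteinU
open Summit.HodgeConjecture.HodgeConjecture.Cruxes.H413.K2E1CharacterEisensteinU2Defs
open Summit.HodgeConjecture.HodgeConjecture.Cruxes.H413.K2E1CharacterEisensteinU3PairDefs
open Summit.HodgeConjecture.HodgeConjecture.Cruxes.H413.K2E1ChiSectionSpaceU3PairDefs
open Summit.HodgeConjecture.HodgeConjecture.Cruxes.H413.K2E1BLBorelSpacesU2Defs Summit.HodgeConjecture.HodgeConjecture.Cruxes.H413.K2E1BLBorelOperatorsU2Defs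
open Summit.HodgeConjecture.HodgeConjecture.Cruxes.H413.K2E1ChiScatteringCoordsEulerFactorisationKFiniteCMThree (exists_eulerFactorisation_of_tubeClause)
open Summit.HodgeConjecture.HodgeConjecture.Cruxes.H413.K2E1ChiIntertwinedCoeffKMaxCMThree (integrable_flatSectionU_weylLongU_mul)
open Literature.MeasureTheory.Group
open scoped ENNReal NNReal

namespace Summit.HodgeConjecture.HodgeConjecture.R90.S8

section Row

variable (L : Type) [Field L] [NumberField L] [IsCMField L]
  [MeasurableSpace (quasiSplit (↥(maximalRealSubfield L)) L (IsCMField.complexConj L) 3).Adelic] [BorelSpace (quasiSplit (↥(maximalRealSubfield L)) L (IsCMField.complexConj L) 3).Adelic]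
  [MeasurableSpace ↥(arch (↥(maximalRealSubfield L)) L (IsCMField.complexConj L) 3 ((StdForm.antidiagonal 3).over L))] [BorelSpace ↥(arch (↥(maximalRealSubfield L)) L (IsCMField.complexConj L) 3 ((StdForm.antidiagonal 3).over L))] [MeasurableSpace ↥(finAdelic (↥(maximalRealSubfield L)) L (IsCMField.complexConj L) 3 ((StdForm.antidiagonal 3).over L))] [BorelSpace ↥(finAdelic (↥(maximalRealSubfield L)) L (IsCMField.complexConj L) 3 ((StdForm.antidiagonal 3).over L))]
  (μ : Measure (quasiSplit (↥(maximalRealSubfield L)) L (IsCMField.complexConj L) 3).automorphicQuotient) [(quasiSplit (↥(maximalRealSubfield L)) L (IsCMField.complexConj L) 3).IsAutomorphicMeasure μ]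
  (νG : Measure (quasiSplit (↥(maximalRealSubfield L)) L (IsCMField.complexConj L) 3).Adelic) [νG.IsHaarMeasure] [νG.IsInvInvariant] [SFinite νG]
  {β : (quasiSplit (↥(maximalRealSubfield L)) L (IsCMField.complexConj L) 3).Adelic → ℝ≥0∞}
  (hβ : IsCoveringWeight ↥((arithmeticBorel (↥(maximalRealSubfield L)) L (IsCMField.complexConj L) 3).map (quasiSplit (↥(maximalRealSubfield L)) L (IsCMField.complexConj L) 3).arithmeticSubgroup.subtype) β)
  {μZ : Measure (borelQuotient (↥(maximalRealSubfield L)) L (IsCMField.complexConj L) 3)} [SFinite μZ]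
  (hμZ : ∀ f : borelQuotient (↥(maximalRealSubfield L)) L (IsCMField.complexConj L) 3 → ℝ≥0∞, Measurable f → ∫⁻ z, f z ∂μZ = ∫⁻ g, β g * f (toBorelQuotient (↥(maximalRealSubfield L)) L (IsCMField.complexConj L) 3 g) ∂νG)
  (μa : Measure ↥(arch (↥(maximalRealSubfield L)) L (IsCMField.complexConj L) 3 ((StdForm.antidiagonal 3).over L))) [μa.IsHaarMeasure] [μa.IsMulRightInvariant]
  (μf : Measure ↥(finAdelic (↥(maximalRealSubfield L)) L (IsCMField.complexConj L) 3 ((StdForm.antidiagonal 3).over L))) [μf.IsHaarMeasure]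
  (ξ : OneDimAutRepH L) (μω : HeckeCharacter L)

/-! ## §1 The scattering columns of a section of a PURE block, of ports -/

include μ hβ hμZ μa μf in
/-- **§1 — `columnsRow_of_pureBlock`**: at a pure `K_max`-irreducible block `V` packaged as ★ §5d and a normalised Heisenberg package, every `φ ∈ V` has SCATTERING COLUMNS: linearly
independent continuous bounded `(χ₁ʷ, χ₂)`-pair-sections `φ′`, tube coordinates `qv`, continued coordinates `qcv` analytic off a co-discrete `Pv ⊆ {Re ≤ 2}` agreeing with `qv` on the
tube, and the tube clause — ★ p865131 §1.2 with ★ p864597's binder discharges (replay of ★ `hPURE6_of_coweightLines'`, columns kept) and ★ `hCO_of_transposeRealisations` for the co-weight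
line. [cite: BernsteinLapid2019, Thm 2.3, §4, §7] [cite: MoeglinWaldspurger1995, II.1.7, IV.1.9–IV.1.11] [cite: Knapp1986, VII §1–§2] -/
theorem columnsRow_of_pureBlock (hμu : μω.IsUnitary) :
    ∀ (U₀ : Subgroup ↥(finAdelic (↥(maximalRealSubfield L)) L (IsCMField.complexConj L) 3 ((StdForm.antidiagonal 3).over L))) (_ : IsTauLevel L U₀) (V : Submodule ℂ ((quasiSplit (↥(maximalRealSubfield L)) L (IsCMField.complexConj L) 3).Adelic → ℂ)) (_ : FiniteDimensional ℂ ↥V)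
      (_ : ∀ k ∈ ((standardMaximalCompactGL 3 L).comap (adelicVal (↥(maximalRealSubfield L)) L (IsCMField.complexConj L) 3 ((StdForm.antidiagonal 3).over L)) : Subgroup (quasiSplit (↥(maximalRealSubfield L)) L (IsCMField.complexConj L) 3).Adelic), ∀ ψ ∈ V, (fun x => ψ (x * k)) ∈ V) (_ : ∀ ψ ∈ V, IsChiSectionPair (ξ.bcη⁻¹ * ξ.bcψ⁻¹ * μω) ξ.ψ ψ) (_ : ∀ ψ ∈ V, Continuous ψ)
      (_ : ∀ ψ ∈ V, ∃ M : ℝ, ∀ x, ‖ψ x‖ ≤ M) (_ : V ≤ chiSectionSpacePair (ξ.bcη⁻¹ * ξ.bcψ⁻¹ * μω) ξ.ψ (tauLevel L U₀) ((1 : ↥(tauLevel L U₀) →* ℂ) : ↥(tauLevel L U₀) → ℂ))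
      (_ : ∃ hV : ∀ k : ↥((standardMaximalCompactGL 3 L).comap (adelicVal (↥(maximalRealSubfield L)) L (IsCMField.complexConj L) 3 ((StdForm.antidiagonal 3).over L)) : Subgroup (quasiSplit (↥(maximalRealSubfield L)) L (IsCMField.complexConj L) 3).Adelic), ∀ ψ ∈ V, ((rightTranslation (quasiSplit (↥(maximalRealSubfield L)) L (IsCMField.complexConj L) 3)).comp ((standardMaximalCompactGL 3 L).comap (adelicVal (↥(maximalRealSubfield L)) L (IsCMField.complexConj L) 3 ((StdForm.antidiagonal 3).over L)) : Subgroup (quasiSplit (↥(maximalRealSubfield L)) L (IsCMField.complexConj L) 3).Adelic).subtype) k ψ ∈ V, (Subrepresentation.toRepresentation (⟨V, hV⟩ : Subrepresentation ((rightTranslation (quasiSplit (↥(maximalRealSubfield L)) L (IsCMField.complexConj L) 3)).comp ((standardMaximalCompactGL 3 L).comap (adelicVal (↥(maximalRealSubfield L)) L (IsCMField.complexConj L) 3 ((StdForm.antidiagonal 3).over L)) : Subgroup (quasiSplit (↥(maximalRealSubfield L)) L (IsCMField.complexConj L) 3).Adelic).subtype))).IsIrreducible)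
      (_ : ∃ (W₀ : Submodule ℂ ((quasiSplit (↥(maximalRealSubfield L)) L (IsCMField.complexConj L) 3).Adelic → ℂ)) (hW₀K : ∀ k : ↥(archMaximalCompact L), ∀ ψ ∈ W₀, ((rightTranslation (quasiSplit (↥(maximalRealSubfield L)) L (IsCMField.complexConj L) 3)).comp (archMaximalCompact L).subtype) k ψ ∈ W₀),
        FiniteDimensional ℂ ↥W₀ ∧ (Subrepresentation.toRepresentation (⟨W₀, hW₀K⟩ : Subrepresentation ((rightTranslation (quasiSplit (↥(maximalRealSubfield L)) L (IsCMField.complexConj L) 3)).comp (archMaximalCompact L).subtype))).IsIrreducible ∧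
        V ≤ chiSectionSpacePairKType (ξ.bcη⁻¹ * ξ.bcψ⁻¹ * μω) ξ.ψ (tauLevel L U₀) ((1 : ↥(tauLevel L U₀) →* ℂ) : ↥(tauLevel L U₀) → ℂ) (archMaximalCompact L).subtype (commute_tauLevel_archMaximalCompact L U₀) (Subrepresentation.toRepresentation (⟨W₀, hW₀K⟩ : Subrepresentation ((rightTranslation (quasiSplit (↥(maximalRealSubfield L)) L (IsCMField.complexConj L) 3)).comp (archMaximalCompact L).subtype))))
      (ν : Measure ↥(adelicUnipotent (↥(maximalRealSubfield L)) L (IsCMField.complexConj L) 3)) (_ : ν.IsHaarMeasure) (𝓕 : Set ↥(adelicUnipotent (↥(maximalRealSubfield L)) L (IsCMField.complexConj L) 3))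
      (_ : IsFundamentalDomain ↥(rationalUnipotent (↥(maximalRealSubfield L)) L (IsCMField.complexConj L) 3) 𝓕 ν) (_ : IsCompact (closure 𝓕)) (_ : ν.IsInvInvariant) (_ : ν 𝓕 = 1),
      ∀ φ ∈ V, ∃ (n : ℕ) (φ' : Fin n → (quasiSplit (↥(maximalRealSubfield L)) L (IsCMField.complexConj L) 3).Adelic → ℂ) (qv qcv : Fin n → ℂ → ℂ) (Pv : Set ℂ),
        LinearIndependent ℂ φ' ∧
        (∀ j, IsChiSectionPair (reflectChar (IsCMField.complexConj L) (ξ.bcη⁻¹ * ξ.bcψ⁻¹ * μω)) ξ.ψ (φ' j)) ∧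
        (∀ j, Continuous (φ' j)) ∧
        (∀ j, ∃ C : ℝ, ∀ x, ‖φ' j x‖ ≤ C) ∧
        (∀ z : ℂ, 2 < z.re → (∑ j, qv j z • φ' j) = ((((ν 𝓕).toReal⁻¹ : ℝ)) : ℂ) • (fun g : (quasiSplit (↥(maximalRealSubfield L)) L (IsCMField.complexConj L) 3).Adelic => (∫ v : ↥(adelicUnipotent (↥(maximalRealSubfield L)) L (IsCMField.complexConj L) 3), flatSectionU φ z ((quasiSplit (↥(maximalRealSubfield L)) L (IsCMField.complexConj L) 3).toAdelic (weylLongU ((IsCMField.complexConj L : L ≃ₐ[↥(maximalRealSubfield L)] L) : L →+* L) (rfl : (StdForm.antidiagonal 3).over L = (StdForm.antidiagonal 3).over L)) * ((v : (quasiSplit (↥(maximalRealSubfield L)) L (IsCMField.complexConj L) 3).Adelic) * g)) ∂ν) * (((borelHeight g : ℝ) : ℂ) ^ (z - 2)))) ∧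
        (∀ z₀ : ℂ, ∀ᶠ s in 𝓝[≠] z₀, s ∉ Pv) ∧
        (∀ z ∈ Pv, z.re ≤ 2) ∧
        (∀ j (z : ℂ), z ∉ Pv → AnalyticAt ℂ (qcv j) z) ∧
        (∀ j (z : ℂ), 2 < z.re → qcv j z = qv j z) ∧
        (∀ j, MeromorphicNFOn (qcv j) univ) := by
  classical
  intro U₀ hU₀ V hVfd hVK hVχ hVc hVM hVlev hVirr _ ν hν 𝓕 h𝓕N h𝓕c hνi hν1 φ hφ
  haveI := hVfd
  haveI := hν
  haveI := hνi
  haveI : ν.IsMulRightInvariant := by rw [← Measure.inv_eq_self ν]; infer_instance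
  have h𝓕₀ : ν 𝓕 ≠ 0 := by rw [hν1]; exact one_ne_zero
  obtain ⟨hV, hirrV⟩ := hVirr
  -- the internal `W`-isotypy of the `K_max`-irreducible block (★ FILE A §A1), keeping `W₀ ≤ V`
  obtain ⟨W₀, hW₀K, hW₀V, hW₀fd, hirr₀, hVτ⟩ := exists_isotypy_of_kMax_irreducible L V hV hirrV
  haveI := hW₀fd
  -- the archimedean left law (★ FILE A §A2) and the `GL₃(𝔸_f)`-level (★ FILE A §A3)
  obtain ⟨cB, hVB, hcBz, hcB0⟩ := exists_archBorelLaw L (V := V) hVχ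
  obtain ⟨U₀', hU₀o, hU₀c, hU₀K, hsub⟩ := exists_GLlevel_of_isTauLevel L hU₀
  have hVU := hVU_of_le_tauLevel L hVlev hsub
  -- the co-weight line for this `τ₀` (★ J-S8-CO (5)), in the ports' spelling
  obtain ⟨l₀, hl₀⟩ := hCO_of_transposeRealisations L ξ μω hμu W₀ hW₀K hW₀fd (fun ψ hψ => hVχ ψ (hW₀V hψ)) (fun ψ hψ => hVc ψ (hW₀V hψ)) hirr₀
  have hco : ∃ l₀ : ↥W₀ →ₗ[ℂ] ℂ, ∀ l : ↥W₀ →ₗ[ℂ] ℂ,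
      (∀ m ∈ (borelAdelic (↥(maximalRealSubfield L)) L (IsCMField.complexConj L) 3).comap (archToAdelic (↥(maximalRealSubfield L)) L (IsCMField.complexConj L) 3 ((StdForm.antidiagonal 3).over L)), m ∈ (((standardMaximalCompactGL 3 L).comap (adelicVal (↥(maximalRealSubfield L)) L (IsCMField.complexConj L) 3 ((StdForm.antidiagonal 3).over L)) : Subgroup (quasiSplit (↥(maximalRealSubfield L)) L (IsCMField.complexConj L) 3).Adelic)).comap (archToAdelic (↥(maximalRealSubfield L)) L (IsCMField.complexConj L) 3 ((StdForm.antidiagonal 3).over L)) →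
        ∀ w, l ((fun a : ↥(arch (↥(maximalRealSubfield L)) L (IsCMField.complexConj L) 3 ((StdForm.antidiagonal 3).over L)) => if h : (adelicVal (↥(maximalRealSubfield L)) L (IsCMField.complexConj L) 3 ((StdForm.antidiagonal 3).over L)) ((archToAdelic (↥(maximalRealSubfield L)) L (IsCMField.complexConj L) 3 ((StdForm.antidiagonal 3).over L)) a) ∈ standardMaximalCompactGL 3 L then (Subrepresentation.toRepresentation (⟨W₀, hW₀K⟩ : Subrepresentation ((rightTranslation (quasiSplit (↥(maximalRealSubfield L)) L (IsCMField.complexConj L) 3)).comp (archMaximalCompact L).subtype))) ⟨(archToAdelic (↥(maximalRealSubfield L)) L (IsCMField.complexConj L) 3 ((StdForm.antidiagonal 3).over L)) a, archToAdelic_mem_archMaximalCompact L a h⟩ else LinearMap.id) m w) = cB 0 m * l w) →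
      ∃ a : ℂ, l = a • l₀ := by
    refine ⟨l₀, fun l hl => hl₀ l fun m hmB hmK w => ?_⟩
    have h := hl m hmB hmK w
    dsimp only at h
    rwa [dif_pos hmK, hcB0 m hmB hmK] at h
  -- the K-finite exports-with-(E6) head with both τ-ports — the COLUMNS KEPT
  obtain ⟨n, φ', q, Ec, qc, P, hli, hb, hc, ⟨Mb, hMb⟩, -, hqφ, -, hNF, -, hqcq, -, hPcd, hPre, -, hqan, -⟩ :=
    chiEisenstein_meromorphic_exports_kfinite_with_truncatedFamily_of_ports_of_coweightLine L (μ := μ) (νG := νG) (ν := ν) h𝓕N h𝓕c h𝓕₀ hβ hμZ μa μf ξ.hψ V hVK hVχ hVc hVM U₀' hU₀o hU₀c hU₀K hVU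
      (fun a : ↥(arch (↥(maximalRealSubfield L)) L (IsCMField.complexConj L) 3 ((StdForm.antidiagonal 3).over L)) => if h : (adelicVal (↥(maximalRealSubfield L)) L (IsCMField.complexConj L) 3 ((StdForm.antidiagonal 3).over L)) ((archToAdelic (↥(maximalRealSubfield L)) L (IsCMField.complexConj L) 3 ((StdForm.antidiagonal 3).over L)) a) ∈ standardMaximalCompactGL 3 L then (Subrepresentation.toRepresentation (⟨W₀, hW₀K⟩ : Subrepresentation ((rightTranslation (quasiSplit (↥(maximalRealSubfield L)) L (IsCMField.complexConj L) 3)).comp (archMaximalCompact L).subtype))) ⟨(archToAdelic (↥(maximalRealSubfield L)) L (IsCMField.complexConj L) 3 ((StdForm.antidiagonal 3).over L)) a, archToAdelic_mem_archMaximalCompact L a h⟩ else LinearMap.id)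
      cB hVB hVτ (cB 0) hcBz hco hφ
  exact ⟨n, φ', q, qc, P, hli, hb, hc, fun j => ⟨Mb, fun x => hMb j x⟩, hqφ, hPcd, hPre, hqan, hqcq, hNF⟩

/-! ## §2 HEAD: the FACTORISED columns of every τ-admissible generator — per pure piece §1 + ★ p864880 + off-axis, then concatenation -/

include μ hβ hμZ μa μf in
/-- **§2 HEAD — `columnsFactorisedRow_of_ports`**: for every τ-admissible generator `(U₀, φ)` and every normalised Heisenberg package, columns `φ′` (continuous bounded `(χ₁ʷ, χ₂)`-pair-
sections — NOT claimed independent), coordinates `qv`, continued coordinates `qcv` (analytic off a co-discrete `Pv ⊆ {Re ≤ 2}`, `= qv` on the tube, ANALYTIC AT EVERY NON-REAL POINT OF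
`{1 < Re}`), the tube clause, and holomorphic `a_j` on `{1<Re}` with `qv_j = c_S·a_j` on the tube (`c_S =` ★ F5's ratio of record) — from `hμu`, the frames, the per-section Euler letter
`hunfK` and the per-section off-axis letter `hPreal` (both applied to the PURE PIECES of `φ` at a normal principal sub-level). PROOF: ★ `exists_normal_tauLevel_le`, ★
`exists_finset_sum_pure_blocks_of_isArchFinite`, §1 per piece, ★ `exists_eulerFactorisation_of_tubeClause` per piece, `hPreal` per piece, concatenation over `Σ i, Fin (n i)`
(`Fintype.sum_sigma`, ★ `flatSectionU_finsetSum`, `integral_finsetSum` ∘ ★ `integrable_flatSectionU_weylLongU_mul`, `eventually_all`).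
[cite: MoeglinWaldspurger1995, II.1.5–II.1.7, IV.1.11] [cite: Langlands1976, §6] [cite: BernsteinLapid2019, §4, §7] -/
theorem columnsFactorisedRow_of_ports (hμu : μω.IsUnitary)
    {S : Set (HeightOneSpectrum (𝓞 L))} {T' : Set (HeightOneSpectrum (𝓞 ↥(maximalRealSubfield L)))}
    (hunfK :
      ∀ (U₀ : Subgroup ↥(finAdelic (↥(maximalRealSubfield L)) L (IsCMField.complexConj L) 3 ((StdForm.antidiagonal 3).over L))) (_ : IsTauLevel L U₀)
      (φ : (quasiSplit (↥(maximalRealSubfield L)) L (IsCMField.complexConj L) 3).Adelic → ℂ) (_ : φ ∈ chiSectionSpacePair (ξ.bcη⁻¹ * ξ.bcψ⁻¹ * μω) ξ.ψ (tauLevel L U₀) ((1 : ↥(tauLevel L U₀) →* ℂ) : ↥(tauLevel L U₀) → ℂ)) (_ : Continuous φ)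
      (_ : IsArchFinite L φ)
      (ν : Measure ↥(adelicUnipotent (↥(maximalRealSubfield L)) L (IsCMField.complexConj L) 3)) (_ : ν.IsHaarMeasure) (𝓕 : Set ↥(adelicUnipotent (↥(maximalRealSubfield L)) L (IsCMField.complexConj L) 3)) (_ : IsFundamentalDomain ↥(rationalUnipotent (↥(maximalRealSubfield L)) L (IsCMField.complexConj L) 3) 𝓕 ν) (_ : IsCompact (closure 𝓕)) (_ : ν.IsInvInvariant) (_ : ν 𝓕 = 1),
      ∀ k : (quasiSplit (↥(maximalRealSubfield L)) L (IsCMField.complexConj L) 3).Adelic, adelicVal (↥(maximalRealSubfield L)) L (IsCMField.complexConj L) 3 ((StdForm.antidiagonal 3).over L) k ∈ standardMaximalCompactGL 3 L →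
        ∃ A' : ℂ → ℂ, DifferentiableOn ℂ A' {z : ℂ | 1 < z.re} ∧ ∀ z : ℂ, 2 < z.re →
          (∫ v : ↥(adelicUnipotent (↥(maximalRealSubfield L)) L (IsCMField.complexConj L) 3), flatSectionU φ z ((quasiSplit (↥(maximalRealSubfield L)) L (IsCMField.complexConj L) 3).toAdelic (weylLongU ((IsCMField.complexConj L : L ≃ₐ[↥(maximalRealSubfield L)] L) : L →+* L) (rfl : (StdForm.antidiagonal 3).over L = (StdForm.antidiagonal 3).over L)) * ((v : (quasiSplit (↥(maximalRealSubfield L)) L (IsCMField.complexConj L) 3).Adelic) * k)) ∂ν) =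
            ((partialStandardL S (fun w => {(ξ.bcη⁻¹ * μω).valueAtUniformizer w}) (z - 1) * partialStandardL T' (fun v => {(1 : HeckeCharacter ↥(maximalRealSubfield L)).valueAtUniformizer v}) (2 * z - 2)) / (partialStandardL S (fun w => {(ξ.bcη⁻¹ * μω).valueAtUniformizer w}) z * partialStandardL T' (fun v => {(1 : HeckeCharacter ↥(maximalRealSubfield L)).valueAtUniformizer v}) (2 * z - 1))) * A' z)
    (hPreal :
      ∀ (U₀ : Subgroup ↥(finAdelic (↥(maximalRealSubfield L)) L (IsCMField.complexConj L) 3 ((StdForm.antidiagonal 3).over L))) (_ : IsTauLevel L U₀)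
      (φ : (quasiSplit (↥(maximalRealSubfield L)) L (IsCMField.complexConj L) 3).Adelic → ℂ) (_ : φ ∈ chiSectionSpacePair (ξ.bcη⁻¹ * ξ.bcψ⁻¹ * μω) ξ.ψ (tauLevel L U₀) ((1 : ↥(tauLevel L U₀) →* ℂ) : ↥(tauLevel L U₀) → ℂ)) (_ : Continuous φ)
      (_ : IsArchFinite L φ)
      (ν : Measure ↥(adelicUnipotent (↥(maximalRealSubfield L)) L (IsCMField.complexConj L) 3)) (_ : ν.IsHaarMeasure) (𝓕 : Set ↥(adelicUnipotent (↥(maximalRealSubfield L)) L (IsCMField.complexConj L) 3)) (_ : IsFundamentalDomain ↥(rationalUnipotent (↥(maximalRealSubfield L)) L (IsCMField.complexConj L) 3) 𝓕 ν) (_ : IsCompact (closure 𝓕)) (_ : ν.IsInvInvariant) (_ : ν 𝓕 = 1),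
      ∀ (ι : Type) [Fintype ι] (φ' : ι → (quasiSplit (↥(maximalRealSubfield L)) L (IsCMField.complexConj L) 3).Adelic → ℂ) (qv qcv : ι → ℂ → ℂ) (Pv : Set ℂ),
        LinearIndependent ℂ φ' →
        (∀ j, IsChiSectionPair (reflectChar (IsCMField.complexConj L) (ξ.bcη⁻¹ * ξ.bcψ⁻¹ * μω)) ξ.ψ (φ' j)) →
        (∀ j, Continuous (φ' j)) →
        (∀ j, ∃ C : ℝ, ∀ x, ‖φ' j x‖ ≤ C) →
        (∀ z : ℂ, 2 < z.re → (∑ j, qv j z • φ' j) = ((((ν 𝓕).toReal⁻¹ : ℝ)) : ℂ) • (fun g : (quasiSplit (↥(maximalRealSubfield L)) L (IsCMField.complexConj L) 3).Adelic => (∫ v : ↥(adelicUnipotent (↥(maximalRealSubfield L)) L (IsCMField.complexConj L) 3), flatSectionU φ z ((quasiSplit (↥(maximalRealSubfield L)) L (IsCMField.complexConj L) 3).toAdelic (weylLongU ((IsCMField.complexConj L : L ≃ₐ[↥(maximalRealSubfield L)] L) : L →+* L) (rfl : (StdForm.antidiagonal 3).over L = (StdForm.antidiagonal 3).over L)) *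 ((v : (quasiSplit (↥(maximalRealSubfield L)) L (IsCMField.complexConj L) 3).Adelic) * g)) ∂ν) * (((borelHeight g : ℝ) : ℂ) ^ (z - 2)))) →
        (∀ z₀ : ℂ, ∀ᶠ s in 𝓝[≠] z₀, s ∉ Pv) →
        (∀ z ∈ Pv, z.re ≤ 2) →
        (∀ j (z : ℂ), z ∉ Pv → AnalyticAt ℂ (qcv j) z) →
        (∀ j (z : ℂ), 2 < z.re → qcv j z = qv j z) →
        (∀ j, MeromorphicNFOn (qcv j) univ) →
      ∀ j (z : ℂ), 1 < z.re → z.im ≠ 0 → AnalyticAt ℂ (qcv j) z) :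
      ∀ (U₀ : Subgroup ↥(finAdelic (↥(maximalRealSubfield L)) L (IsCMField.complexConj L) 3 ((StdForm.antidiagonal 3).over L))) (_ : IsTauLevel L U₀)
      (φ : (quasiSplit (↥(maximalRealSubfield L)) L (IsCMField.complexConj L) 3).Adelic → ℂ) (_ : φ ∈ chiSectionSpacePair (ξ.bcη⁻¹ * ξ.bcψ⁻¹ * μω) ξ.ψ (tauLevel L U₀) ((1 : ↥(tauLevel L U₀) →* ℂ) : ↥(tauLevel L U₀) → ℂ)) (_ : Continuous φ)
      (_ : IsArchFinite L φ)
      (ν : Measure ↥(adelicUnipotent (↥(maximalRealSubfield L)) L (IsCMField.complexConj L) 3)) (_ : ν.IsHaarMeasure) (𝓕 : Set ↥(adelicUnipotent (↥(maximalRealSubfield L)) L (IsCMField.complexConj L) 3)) (_ : IsFundamentalDomain ↥(rationalUnipotent (↥(maximalRealSubfield L)) L (IsCMField.complexConj L) 3) 𝓕 ν) (_ : IsCompact (closure 𝓕)) (_ : ν.IsInvInvariant) (_ : ν 𝓕 = 1),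
      ∃ (ι : Type) (_ : Fintype ι) (φ' : ι → (quasiSplit (↥(maximalRealSubfield L)) L (IsCMField.complexConj L) 3).Adelic → ℂ) (qv qcv : ι → ℂ → ℂ) (Pv : Set ℂ) (a : ι → ℂ → ℂ),
        (∀ j, IsChiSectionPair (reflectChar (IsCMField.complexConj L) (ξ.bcη⁻¹ * ξ.bcψ⁻¹ * μω)) ξ.ψ (φ' j)) ∧
        (∀ j, Continuous (φ' j)) ∧
        (∀ j, ∃ C : ℝ, ∀ x, ‖φ' j x‖ ≤ C) ∧
        (∀ z : ℂ, 2 < z.re → (∑ j, qv j z • φ' j) = ((((ν 𝓕).toReal⁻¹ : ℝ)) : ℂ) • (fun g : (quasiSplit (↥(maximalRealSubfield L)) L (IsCMField.complexConj L) 3).Adelic => (∫ v : ↥(adelicUnipotent (↥(maximalRealSubfield L)) L (IsCMField.complexConj L) 3), flatSectionU φ z ((quasiSplit (↥(maximalRealSubfield L)) L (IsCMField.complexConj L) 3).toAdelic (weylLongU ((IsCMField.complexConj L : L ≃ₐ[↥(maximalRealSubfield L)] L) : L →+* L) (rfl : (StdForm.antidiagonal 3).over L = (StdForm.antidiagonal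 3).over L)) * ((v : (quasiSplit (↥(maximalRealSubfield L)) L (IsCMField.complexConj L) 3).Adelic) * g)) ∂ν) * (((borelHeight g : ℝ) : ℂ) ^ (z - 2)))) ∧
        (∀ z₀ : ℂ, ∀ᶠ s in 𝓝[≠] z₀, s ∉ Pv) ∧
        (∀ z ∈ Pv, z.re ≤ 2) ∧
        (∀ j (z : ℂ), z ∉ Pv → AnalyticAt ℂ (qcv j) z) ∧
        (∀ j (z : ℂ), 2 < z.re → qcv j z = qv j z) ∧
        (∀ j, MeromorphicNFOn (qcv j) univ) ∧
        (∀ j, DifferentiableOn ℂ (a j) {z : ℂ | 1 < z.re}) ∧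
        (∀ j (z : ℂ), 2 < z.re → qv j z = ((partialStandardL S (fun w => {(ξ.bcη⁻¹ * μω).valueAtUniformizer w}) (z - 1) * partialStandardL T' (fun v => {(1 : HeckeCharacter ↥(maximalRealSubfield L)).valueAtUniformizer v}) (2 * z - 2)) / (partialStandardL S (fun w => {(ξ.bcη⁻¹ * μω).valueAtUniformizer w}) z * partialStandardL T' (fun v => {(1 : HeckeCharacter ↥(maximalRealSubfield L)).valueAtUniformizer v}) (2 * z - 1))) * a j z) ∧
        (∀ j (z : ℂ), 1 < z.re → z.im ≠ 0 → AnalyticAt ℂ (qcv j) z) := by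
  classical
  intro U₀ hU₀ φ hφ hφc hφa ν hν 𝓕 h𝓕N h𝓕c hνi hν1
  haveI := hν
  -- a normal principal level below `U₀`; `φ` is bounded
  obtain ⟨U₁, hU₁U₀, hU₁, hN⟩ := exists_normal_tauLevel_le L hU₀
  have hφ₁ := chiSectionSpacePair_tauLevel_mono L (χ₁ := (ξ.bcη⁻¹ * ξ.bcψ⁻¹ * μω)) (χ₂ := ξ.ψ) hU₁U₀ hφ
  have hφM : ∃ M : ℝ, ∀ x, ‖φ x‖ ≤ M := exists_bound_of_mem_chiSectionSpacePair_midBlock L ξ hμu hφ hφc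
  -- split into pure blocks at the normal level `U₁`
  obtain ⟨ι, hι, V, cf, hsumφ, hcf⟩ := exists_finset_sum_pure_blocks_of_isArchFinite L ξ μω hU₁ hN hφ₁ hφc hφM hφa
  -- per piece: membership, level, continuity, bound, arch-finiteness
  have hcV : ∀ i, cf i ∈ V i := fun i => (hcf i).1
  have hcflev : ∀ i, cf i ∈ chiSectionSpacePair (ξ.bcη⁻¹ * ξ.bcψ⁻¹ * μω) ξ.ψ (tauLevel L U₁) ((1 : ↥(tauLevel L U₁) →* ℂ) : ↥(tauLevel L U₁) → ℂ) := fun i =>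
    (hcf i).2.2.2.2.2.2.2.1 (hcV i)
  have hcfc : ∀ i, Continuous (cf i) := fun i => (hcf i).2.2.2.2.2.1 _ (hcV i)
  have hcfM : ∀ i, ∃ M : ℝ, ∀ x, ‖cf i x‖ ≤ M := fun i => (hcf i).2.2.2.2.2.2.1 _ (hcV i)
  have hcfa : ∀ i, IsArchFinite L (cf i) := fun i => by
    haveI := (hcf i).2.2.1
    obtain ⟨hVst, -⟩ := (hcf i).2.2.2.2.2.2.2.2.1
    exact isArchFinite_of_mem_of_finiteDimensional L (fun k ψ hψ => hVst ⟨(k : (quasiSplit (↥(maximalRealSubfield L)) L (IsCMField.complexConj L) 3).Adelic), k.2.1⟩ ψ hψ) (hcV i)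
  -- per piece: the columns (§1), the Euler factorisation (★ p864880 at the scalar of record), the off-axis exclusion
  have hcols : ∀ i, ∃ (n : ℕ) (φ' : Fin n → (quasiSplit (↥(maximalRealSubfield L)) L (IsCMField.complexConj L) 3).Adelic → ℂ) (qv qcv : Fin n → ℂ → ℂ) (Pv : Set ℂ),
        LinearIndependent ℂ φ' ∧
        (∀ j, IsChiSectionPair (reflectChar (IsCMField.complexConj L) (ξ.bcη⁻¹ * ξ.bcψ⁻¹ * μω)) ξ.ψ (φ' j)) ∧
        (∀ j, Continuous (φ' j)) ∧
        (∀ j, ∃ C : ℝ, ∀ x, ‖φ' j x‖ ≤ C) ∧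
        (∀ z : ℂ, 2 < z.re → (∑ j, qv j z • φ' j) = ((((ν 𝓕).toReal⁻¹ : ℝ)) : ℂ) • (fun g : (quasiSplit (↥(maximalRealSubfield L)) L (IsCMField.complexConj L) 3).Adelic => (∫ v : ↥(adelicUnipotent (↥(maximalRealSubfield L)) L (IsCMField.complexConj L) 3), flatSectionU (cf i) z ((quasiSplit (↥(maximalRealSubfield L)) L (IsCMField.complexConj L) 3).toAdelic (weylLongU ((IsCMField.complexConj L : L ≃ₐ[↥(maximalRealSubfield L)] L) : L →+* L) (rfl : (StdForm.antidiagonal 3).over L = (StdForm.antidiagonal 3).over L)) * ((v : (quasiSplit (↥(maximalRealSubfield L)) L (IsCMField.complexConj L) 3).Adelic) * g)) ∂ν) * (((borelHeight g : ℝ) : ℂ) ^ (z - 2)))) ∧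
        (∀ z₀ : ℂ, ∀ᶠ s in 𝓝[≠] z₀, s ∉ Pv) ∧
        (∀ z ∈ Pv, z.re ≤ 2) ∧
        (∀ j (z : ℂ), z ∉ Pv → AnalyticAt ℂ (qcv j) z) ∧
        (∀ j (z : ℂ), 2 < z.re → qcv j z = qv j z) ∧
        (∀ j, MeromorphicNFOn (qcv j) univ) := fun i => by
    obtain ⟨hcVi, -, hVfd, hVK, hVχ, hVc, hVM, hVlev, hVirr, hVpure⟩ := hcf i
    exact columnsRow_of_pureBlock L μ νG hβ hμZ μa μf ξ μω hμu U₁ hU₁ (V i) hVfd hVK hVχ hVc hVM hVlev hVirr hVpure ν hν 𝓕 h𝓕N h𝓕c hνi hν1 (cf i) hcVi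
  choose n φ' qv qcv Pv hli hb hc hbd hqφ hPcd hPre hqan hqcq hNF using hcols
  have heul : ∀ i, ∃ a : Fin (n i) → ℂ → ℂ, (∀ j, DifferentiableOn ℂ (a j) {z : ℂ | 1 < z.re}) ∧ ∀ j (z : ℂ), 2 < z.re → qv i j z = ((partialStandardL S (fun w => {(ξ.bcη⁻¹ * μω).valueAtUniformizer w}) (z - 1) * partialStandardL T' (fun v => {(1 : HeckeCharacter ↥(maximalRealSubfield L)).valueAtUniformizer v}) (2 * z - 2)) / (partialStandardL S (fun w => {(ξ.bcη⁻¹ * μω).valueAtUniformizer w}) z * partialStandardL T' (fun v => {(1 : HeckeCharacter ↥(maximalRealSubfield L)).valueAtUniformizer v}) (2 * z - 1))) * a j z := fun i =>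
    exists_eulerFactorisation_of_tubeClause L (hli i) (hb i) ν 𝓕 (hqφ i) (hunfK U₁ hU₁ (cf i) (hcflev i) (hcfc i) (hcfa i) ν hν 𝓕 h𝓕N h𝓕c hνi hν1)
  choose a ha hqva using heul
  have hoff : ∀ i j (z : ℂ), 1 < z.re → z.im ≠ 0 → AnalyticAt ℂ (qcv i j) z := fun i =>
    hPreal U₁ hU₁ (cf i) (hcflev i) (hcfc i) (hcfa i) ν hν 𝓕 h𝓕N h𝓕c hνi hν1 (Fin (n i)) (φ' i) (qv i) (qcv i) (Pv i) (hli i) (hb i) (hc i) (hbd i) (hqφ i) (hPcd i) (hPre i) (hqan i) (hqcq i) (hNF i)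
  -- integrability of every piece's intertwining integrand on the tube (Godement ★)
  have hInt : ∀ i (z : ℂ), 2 < z.re → ∀ g : (quasiSplit (↥(maximalRealSubfield L)) L (IsCMField.complexConj L) 3).Adelic, Integrable (fun v : ↥(adelicUnipotent (↥(maximalRealSubfield L)) L (IsCMField.complexConj L) 3) => flatSectionU (cf i) z ((quasiSplit (↥(maximalRealSubfield L)) L (IsCMField.complexConj L) 3).toAdelic (weylLongU ((IsCMField.complexConj L : L ≃ₐ[↥(maximalRealSubfield L)] L) : L →+* L) (rfl : (StdForm.antidiagonal 3).over L = (StdForm.antidiagonal 3).over L)) * ((v : (quasiSplit (↥(maximalRealSubfield L)) L (IsCMField.complexConj L) 3).Adelic) * g))) ν := fun i z hz g => by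
    obtain ⟨M, hM⟩ := hcfM i
    exact integrable_flatSectionU_weylLongU_mul L ν h𝓕N h𝓕c (hcfc i) hM hz g
  have hnot : ∀ {z : ℂ}, z ∉ (⋃ i, Pv i) → ∀ i, z ∉ Pv i := fun hz i h => hz (mem_iUnion.2 ⟨i, h⟩)
  -- CONCATENATION over the sigma index type
  refine ⟨(Σ i, Fin (n i)), inferInstance, fun x => φ' x.1 x.2, fun x => qv x.1 x.2, fun x => qcv x.1 x.2, ⋃ i, Pv i, fun x => a x.1 x.2,
    fun x => hb x.1 x.2, fun x => hc x.1 x.2, fun x => hbd x.1 x.2, fun z hz => ?_, fun z₀ => ?_, fun z hz => ?_, fun x z hz => hqan x.1 x.2 z (hnot hz x.1),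
    fun x z hz => hqcq x.1 x.2 z hz, fun x => hNF x.1 x.2, fun x => ha x.1 x.2, fun x z hz => hqva x.1 x.2 z hz, fun x z hz hzi => hoff x.1 x.2 z hz hzi⟩
  · -- the tube clause adds up
    rw [Fintype.sum_sigma]
    have hi : ∀ i, (∑ j, qv i j z • φ' i j) = ((((ν 𝓕).toReal⁻¹ : ℝ)) : ℂ) • (fun g : (quasiSplit (↥(maximalRealSubfield L)) L (IsCMField.complexConj L) 3).Adelic => (∫ v : ↥(adelicUnipotent (↥(maximalRealSubfield L)) L (IsCMField.complexConj L) 3), flatSectionU (cf i) z ((quasiSplit (↥(maximalRealSubfield L)) L (IsCMField.complexConj L) 3).toAdelic (weylLongU ((IsCMField.complexConj L : L ≃ₐ[↥(maximalRealSubfield L)] L) : L →+* L) (rfl : (StdForm.antidiagonal 3).over L = (StdForm.antidiagonal 3).over L)) * ((v : (quasiSplit (↥(maximalRealSubfield L)) L (IsCMField.complexConj L) 3).Adelic) * g)) ∂ν) * (((borelHeight g : ℝ) : ℂ) ^ (z - 2))) := fun i => hqφ i z hz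
    rw [Finset.sum_congr rfl fun i _ => hi i, ← Finset.smul_sum]
    congr 1
    funext g
    rw [Finset.sum_apply, ← Finset.sum_mul, ← integral_finsetSum _ fun i _ => hInt i z hz g]
    congr 1
    refine integral_congr_ae (Eventually.of_forall fun v => ?_)
    have hφz : flatSectionU φ z = ∑ i, flatSectionU (cf i) z := by rw [hsumφ, flatSectionU_finsetSum]
    simp only [hφz, Finset.sum_apply]
  · -- the candidate sets unite to a co-discrete set
    exact (eventually_all.2 fun i => hPcd i z₀).mono fun s hs h => by
      obtain ⟨i, hi'⟩ := mem_iUnion.1 h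
      exact hs i hi'
  · obtain ⟨i, hi'⟩ := mem_iUnion.1 hz
    exact hPre i z hi'

end Row

end Summit.HodgeConjecture.HodgeConjecture.R90.S8

end
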